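import Mathlib.Analysis.SpecialFunctions.Complex.Circle
import Mathlib.Topology.ContinuousOn
import HarnessLib

/-!
# The centre is approachable from the regular torus: `(𝓝[{x | Injective x}] (ζ,ζ,ζ)).NeBot` — the instance binder of the two-sided descent ★ `descent_two_sided_prod_mul_eq′`
# (Rogawski 1990 §8.4 p. 126: the limit «at `γ₀`» is taken through regular points)

Topic `NumberTheory/Rogawski1990`; namespace `Literature.NumberTheory.Rogawski1990`.  THEOREMS ONLY (no `def`, no instance, no notation, no axiom, no named fact, no `sorry`);
Mathlib-only imports.  Cell `pub/hodgecm-mathlib`, ENGINE T1 (crux H413 = `stmt-HodgeConjecture-24833`); ROAD-Sd residual R4, SdArch ED. 3 node N6 support lemma **(S2)** of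
F0P3a-p03 (g11)'s assembly brief 2026-09-01T08:17:35Z (dealt to the p02 lineage, cut by F0P3a-p06 (g11) while that seat was unfilled — it is the `[∀ w, (𝓝[R] (x₀ w)).NeBot]` binder
of the author's own ★ p842302∕ED. 2 `descent_two_sided_prod_mul_eq′`).

WHAT IS PROVED.
* `injective_ray_zero_one_two` — for `0 < s < ½` the point `(ζe^{i·0·s}, ζe^{i·1·s}, ζe^{i·2·s})` of the circle torus is REGULAR (pairwise distinct: `e^{it} = e^{it′}` forces `t − t′ ∈ 2πℤ`).
* **`nhdsWithin_injective_const_neBot (ζ) : (𝓝[{x : Fin 3 → Circle | Function.Injective x}] (fun _ => ζ)).NeBot`** — the centre `(ζ,ζ,ζ)` lies in the closure of the regular set (limit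
  of the ray as `s → 0⁺`), so limits «as `z → ζ•1` through regular `z`» (the (L_{U(2,1)}) letter ★ p842205, ★ p842193-ED. 2) are taken along a proper filter and are unique.
HONEST LABEL: HC_CM is proved only modulo the printed citations until rung 0 closes; this file is bookkeeping and pays nothing by itself.

## References
* [Rogawski1990] J. D. Rogawski, *Automorphic Representations of Unitary Groups in Three Variables*, Ann. of Math. Stud. 123 (1990), §8.4 p. 126.
-/

set_option autoImplicit false

noncomputable section

open Filter Topology Set

namespace Literature.NumberTheory.Rogawski1990

/-- Two circle exponentials `e^{ia}`, `e^{ib}` with `|a − b| < 1`, `a ≠ b` are distinct (equality forces `a − b ∈ 2πℤ`). [cite: Rogawski1990, §8.4 p. 126] -/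
theorem circleExp_ne_of_sub_small {a b : ℝ} (hab : a ≠ b) (hsmall : |a - b| < 1) : Circle.exp a ≠ Circle.exp b := by
  intro h
  obtain ⟨m, hm⟩ := Circle.exp_eq_exp.1 h
  have hm' : a - b = m * (2 * Real.pi) := by linarith
  by_cases hm0 : (m : ℝ) = 0
  · apply hab
    have : a - b = 0 := by rw [hm', hm0, zero_mul]
    linarith
  · have hm1 : (1 : ℝ) ≤ |(m : ℝ)| := by
      rw [← Int.cast_abs]
      exact_mod_cast Int.one_le_abs (by exact_mod_cast hm0)
    have hpi : (1 : ℝ) < 2 * Real.pi := by linarith [Real.two_le_pi]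
    have h2 : (1 : ℝ) ≤ |a - b| := by
      rw [hm', abs_mul, abs_of_pos (by linarith [Real.two_le_pi] : (0 : ℝ) < 2 * Real.pi)]
      nlinarith
    linarith

/-- **The ray `(ζe^{i·0·s}, ζe^{i·1·s}, ζe^{i·2·s})` is regular for `0 < s < ½`.** [cite: Rogawski1990, §8.4 p. 126] -/
theorem injective_ray_zero_one_two (ζ : Circle) {s : ℝ} (hs : 0 < s) (hs1 : s < 1 / 2) :
    Function.Injective (fun k : Fin 3 => ζ * Circle.exp (s * ((k : ℕ) : ℝ))) := by
  intro i j hij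
  have h : Circle.exp (s * ((i : ℕ) : ℝ)) = Circle.exp (s * ((j : ℕ) : ℝ)) := mul_left_cancel hij
  by_contra hne
  have hne' : ((i : ℕ) : ℝ) ≠ ((j : ℕ) : ℝ) := by
    intro h'
    exact hne (Fin.ext (by exact_mod_cast h'))
  refine circleExp_ne_of_sub_small (a := s * ((i : ℕ) : ℝ)) (b := s * ((j : ℕ) : ℝ)) ?_ ?_ h
  · intro h'
    exact hne' (mul_left_cancel₀ hs.ne' h')
  · have hi : ((i : ℕ) : ℝ) ≤ 2 := by
      have := i.isLt
      exact_mod_cast Nat.lt_succ_iff.mp this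
    have hj : ((j : ℕ) : ℝ) ≤ 2 := by
      have := j.isLt
      exact_mod_cast Nat.lt_succ_iff.mp this
    have hi0 : (0 : ℝ) ≤ ((i : ℕ) : ℝ) := by positivity
    have hj0 : (0 : ℝ) ≤ ((j : ℕ) : ℝ) := by positivity
    rw [← mul_sub, abs_mul, abs_of_pos hs]
    have hd : |((i : ℕ) : ℝ) - ((j : ℕ) : ℝ)| ≤ 2 := by
      rw [abs_le]; constructor <;> linarith
    have hd0 : 0 ≤ |((i : ℕ) : ℝ) - ((j : ℕ) : ℝ)| := abs_nonneg _
    nlinarith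

/-- **THE CENTRE IS APPROACHABLE FROM THE REGULAR SET**: `(𝓝[{x | Injective x}] (fun _ => ζ)).NeBot` on `(S¹)³` — the ray `s ↦ (ζe^{i·0·s}, ζe^{i·1·s}, ζe^{i·2·s})`, regular for small
`s > 0`, tends to `(ζ,ζ,ζ)`.  The instance binder of ★ `descent_two_sided_prod_mul_eq′` at `R := {Injective}`, `x₀ w := fun _ => ζ_w`. [cite: Rogawski1990, §8.4 p. 126] -/
theorem nhdsWithin_injective_const_neBot (ζ : Circle) :
    (𝓝[{x : Fin 3 → Circle | Function.Injective x}] (fun _ : Fin 3 => ζ)).NeBot := by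
  refine mem_closure_iff_nhdsWithin_neBot.mp ?_
  have hc : Continuous fun s : ℝ => (fun k : Fin 3 => ζ * Circle.exp (s * ((k : ℕ) : ℝ))) :=
    continuous_pi fun k => continuous_const.mul (Circle.exp.continuous.comp (continuous_id.mul continuous_const))
  have h0 : (fun k : Fin 3 => ζ * Circle.exp ((0 : ℝ) * ((k : ℕ) : ℝ))) = fun _ => ζ := by
    funext k; simp
  have ht : Tendsto (fun s : ℝ => (fun k : Fin 3 => ζ * Circle.exp (s * ((k : ℕ) : ℝ)))) (𝓝[>] (0 : ℝ)) (𝓝 (fun _ : Fin 3 => ζ)) := by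
    have := (hc.tendsto (0 : ℝ)).mono_left (nhdsWithin_le_nhds (s := Ioi (0 : ℝ)))
    rwa [h0] at this
  refine mem_closure_of_tendsto ht ?_
  have hI : Ioo (0 : ℝ) (1 / 2) ∈ 𝓝[>] (0 : ℝ) := Ioo_mem_nhdsGT (by norm_num)
  filter_upwards [hI] with s hs
  exact injective_ray_zero_one_two ζ hs.1 hs.2

end Literature.NumberTheory.Rogawski1990

end
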